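/-
Copyright: derived here (Resolution Observatory cell `pub-rosobs`, carver gen 58). AI-written Lean; AI review is weaker than expert
review.  The exponent / binomial / Frobenius bookkeeping of engine 1's THEOREM B″ (THEOREM-LT-eng1-g38 §11, the two-class boundary
systems) for the cell's POLYNOMIAL weighted-centre model `W(f)`.  Instrument — NOT a resolution theorem and NOT a statement about the
invariant of [AbramovichTemkinWlodarczyk2024].
-/
import Mathlib.Algebra.CharP.Lemmas
import Mathlib.Data.Nat.Choose.Basic
import Mathlib.Data.Nat.Choose.Dvd
import Mathlib.Algebra.BigOperators.Ring.Finset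
import Mathlib.Tactic.FieldSimp
import Mathlib.Tactic.Linarith
import Mathlib.Tactic.NormNum
import Mathlib.Tactic.Positivity
import Mathlib.Tactic.Ring
import Mathlib.Tactic.LinearCombination
import HarnessLib

/-!
# Two-class arithmetic: the bookkeeping of THEOREM B″ (slots of weights `1/p` and `1/(p+1)` at the sharp rate `ρ₁ = 1/(p(p+1))`)

Uniform value line: INSTRUMENT — kernel-checked side conditions (natural-number exponent equations, binomial coefficients modulo `p`,
Frobenius identities) of engine 1's THEOREM B″ (THEOREM-LT-eng1-g38 §11) in the cell's polynomial weighted-centre model `W(f)`; NOT a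
resolution theorem, NOT a statement about the Abramovich–Temkin–Włodarczyk invariant, NOT summit progress, and NOT a proof of
THEOREM B″ (a normal form of the pairs `(g, Φ)`; its polynomial part is `WeightedCentreFrobeniusPin`, its Hasse calculus
`WeightedCentreHasseSubspace`); AI-written Lean, AI review is weaker than expert review.  Companion of `WeightedCentreBoundaryArith`
(PROPOSITION B) — here the two-class setting `N = {f₁…f_m} (1/p) ∪ {W₁…W_n} (1/(p+1))`.

## Dictionary (THEOREM-LT §11 ↔ this file)

* BOOKKEEPING (i) "value-1 monomials `f^α W^β`: `|α|(p+1) + |β|p = p(p+1)`, so `(|α|,|β|) ∈ {(p,0),(0,p+1)}`" (`g = F(f) + Q(W)`, no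
  mixed monomials): `value_one_iff` (clearing denominators) and **`value_one_exponents`**.
* BOOKKEEPING (ii) "terms of `Φ`": on a slot of weight `1/p`, `σ^s f^α W^β` with `s + (p+1)|α| + p|β| = p+1`, `s ≥ 1` ⇒
  `(s,|α|,|β|) ∈ {(1,0,1),(p+1,0,0)}` (`f_i ↦ f_i + σℓ_i(W) + d_iσ^{p+1}`): `shift_weight_f_iff`, **`shift_exponents_f`**; on a slot of
  weight `1/(p+1)`, `= p` ⇒ `(p,0,0)` (`W_j ↦ W_j + c_jσ^p`): `shift_weight_W_iff`, **`shift_exponents_W`**.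
* The `σ`-layers of (★): "the exponents `k(p+1)` (`1 ≤ k ≤ p−1`) are not multiples of `p`" (`not_dvd_mul_succ`), and a coincidence
  `k(p+1) = k'p` with `1 ≤ k ≤ p` forces `k = p`, `k' = p+1` (`mul_succ_eq_mul`) — so the layers `σ^p`, `σ^{kp}` (`2 ≤ k ≤ p`),
  `σ^{k(p+1)}` (`k ≤ p−1`) and `σ^{p(p+1)}` separate as the proof reads them.
* The triangular elimination "`C(a,2) ≠ 0` (`2 ≤ a ≤ p−1`), `C(p,p) = 1`, `C(p+1,p) = p+1 ≡ 1`" killing `Q_a` for `2 ≤ a ≤ p+1`: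
  `cast_choose_ne_zero` (no binomial coefficient `C(a,k)`, `k ≤ a < p`, vanishes in characteristic `p` — Mathlib's
  `Nat.Prime.coprime_choose_of_lt`), `cast_choose_self`, `cast_choose_succ_self`; and the complementary vanishing `C(p,2) ≡ C(p+1,2) ≡ 0` for odd `p` (`dvd_choose_two_self`,
  `dvd_choose_two_succ`) explaining why `k = 2` does NOT kill `a ∈ {p, p+1}`.
* Frobenius: `v_i^p = (σℓ_i + σ^{p+1}d_i)^p = σ^pℓ_i^p + σ^{p(p+1)}d_i^p` (`shift_pow_char`); `ℓ^p = Σ_j c_j^p W_j^p`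
  (`linearForm_pow_char`); `(W_n + t)^{p+1} = (W_n + t)(W_n^p + t^p) = W_n^{p+1} + tW_n^p + t^pW_n + t^{p+1}` (`add_pow_succ_char`), whose
  `t·W_n^p`-term is the one the proof uses for `a = p+1`.
* COUNT: `#pairs (g,Φ) = (p−1)³p(p+1) = 96, 1920, 12096` at `p = 3, 5, 7` (`count_pairs_3/5/7`; the machine-matched numbers).

References: [Hironaka1970AdditiveGroups] (additive polynomials, Frobenius); binomial coefficients modulo a prime [cite: Lang2002, Ch. IV §1];
context [AbramovichTemkinWlodarczyk2024] §5 (weights of weighted centres).  Statements ours, elementary.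
-/

namespace Literature.AlgebraicGeometry.Resolution.WeightedBlowup

namespace TwoClassArith

/-! ## §1 Value-`1` monomials: `g = F(f) + Q(W)` -/

/-- Clearing denominators: `|α|·(1/p) + |β|·(1/(p+1)) = 1 ↔ |α|(p+1) + |β|p = p(p+1)`. [cite: AbramovichTemkinWlodarczyk2024, §5] -/
theorem value_one_iff {p : ℕ} (hp : 0 < p) (A B : ℕ) :
    (A : ℚ) * (1 / p) + B * (1 / (p + 1)) = 1 ↔ A * (p + 1) + B * p = p * (p + 1) := by
  have hp' : (0 : ℚ) < p := by exact_mod_cast hp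
  constructor
  · intro h
    have h' : (A : ℚ) * (p + 1) + B * p = p * (p + 1) := by
      field_simp at h
      linarith
    exact_mod_cast h'
  · intro h
    have h' : (A : ℚ) * (p + 1) + B * p = p * (p + 1) := by exact_mod_cast h
    field_simp
    linarith

/-- **BOOKKEEPING (i).**  `|α|(p+1) + |β|p = p(p+1)` forces `(|α|,|β|) = (p,0)` or `(0,p+1)`: a value-`1` monomial in the two classes is a
pure `f`-monomial of degree `p` or a pure `W`-monomial of degree `p+1`. (derived here) [cite: AbramovichTemkinWlodarczyk2024, §5] -/
theorem value_one_exponents {p A B : ℕ} (hp : 0 < p) (h : A * (p + 1) + B * p = p * (p + 1)) :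
    A = p ∧ B = 0 ∨ A = 0 ∧ B = p + 1 := by
  have hdvd : p ∣ A := by
    have h1 : p ∣ A * (p + 1) + B * p := ⟨p + 1, by rw [h]⟩
    have h2 : p ∣ A * (p + 1) := (Nat.dvd_add_left (dvd_mul_left p B)).mp h1
    have h3 : A * (p + 1) = p * A + A := by ring
    rw [h3] at h2
    exact (Nat.dvd_add_right (dvd_mul_right p A)).mp h2
  obtain ⟨t, rfl⟩ := hdvd
  have ht : t * (p + 1) + B = p + 1 := by
    have h' : p * (t * (p + 1) + B) = p * (p + 1) := by rw [← h]; ring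
    exact Nat.eq_of_mul_eq_mul_left hp h'
  rcases t with _ | _ | t
  · right; constructor <;> omega
  · left; constructor <;> [ring; omega]
  · exfalso; nlinarith

/-! ## §2 The terms of `Φ` -/

/-- Clearing denominators on a slot of weight `1/p`: `s·ρ₁ + |α|/p + |β|/(p+1) = 1/p ↔ s + (p+1)|α| + p|β| = p+1`.
[cite: AbramovichTemkinWlodarczyk2024, §5] -/
theorem shift_weight_f_iff {p : ℕ} (hp : 0 < p) (s a b : ℕ) :
    (s : ℚ) * (1 / ((p : ℚ) * (p + 1))) + a * (1 / p) + b * (1 / (p + 1)) = 1 / p ↔ s + (p + 1) * a + p * b = p + 1 := by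
  have hp' : (0 : ℚ) < p := by exact_mod_cast hp
  constructor
  · intro h
    have h' : (s : ℚ) + (p + 1) * a + p * b = p + 1 := by
      field_simp at h
      linarith
    exact_mod_cast h'
  · intro h
    have h' : (s : ℚ) + (p + 1) * a + p * b = p + 1 := by exact_mod_cast h
    field_simp
    linarith

/-- **BOOKKEEPING (ii), slots of weight `1/p`.**  `s + (p+1)|α| + p|β| = p+1` with `s ≥ 1` forces `(s,|α|,|β|) = (1,0,1)` or `(p+1,0,0)`:
`f_i ↦ f_i + σ·ℓ_i(W) + d_i·σ^{p+1}` with `ℓ_i` LINEAR in `W`. (derived here) [cite: AbramovichTemkinWlodarczyk2024, §5] -/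
theorem shift_exponents_f {p s a b : ℕ} (hp : 0 < p) (hs : 1 ≤ s) (h : s + (p + 1) * a + p * b = p + 1) :
    s = 1 ∧ a = 0 ∧ b = 1 ∨ s = p + 1 ∧ a = 0 ∧ b = 0 := by
  have ha : a = 0 := by
    rcases a with _ | a
    · rfl
    · exfalso; nlinarith
  subst ha
  rcases b with _ | _ | b
  · right; refine ⟨?_, rfl, rfl⟩; omega
  · left; refine ⟨?_, rfl, rfl⟩; nlinarith
  · exfalso; nlinarith

/-- Clearing denominators on a slot of weight `1/(p+1)`: `s·ρ₁ + |α|/p + |β|/(p+1) = 1/(p+1) ↔ s + (p+1)|α| + p|β| = p`.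
[cite: AbramovichTemkinWlodarczyk2024, §5] -/
theorem shift_weight_W_iff {p : ℕ} (hp : 0 < p) (s a b : ℕ) :
    (s : ℚ) * (1 / ((p : ℚ) * (p + 1))) + a * (1 / p) + b * (1 / (p + 1)) = 1 / (p + 1) ↔ s + (p + 1) * a + p * b = p := by
  have hp' : (0 : ℚ) < p := by exact_mod_cast hp
  constructor
  · intro h
    have h' : (s : ℚ) + (p + 1) * a + p * b = p := by
      field_simp at h
      linarith
    exact_mod_cast h'
  · intro h
    have h' : (s : ℚ) + (p + 1) * a + p * b = p := by exact_mod_cast h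
    field_simp
    linarith

/-- **BOOKKEEPING (ii), slots of weight `1/(p+1)`.**  `s + (p+1)|α| + p|β| = p` with `s ≥ 1` forces `(s,|α|,|β|) = (p,0,0)`:
`W_j ↦ W_j + c_j·σ^p`, a PURE shift. (derived here) [cite: AbramovichTemkinWlodarczyk2024, §5] -/
theorem shift_exponents_W {p s a b : ℕ} (hs : 1 ≤ s) (h : s + (p + 1) * a + p * b = p) : s = p ∧ a = 0 ∧ b = 0 := by
  have ha : a = 0 := by
    rcases a with _ | a
    · rfl
    · exfalso; nlinarith
  subst ha
  have hb : b = 0 := by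
    rcases b with _ | b
    · rfl
    · exfalso; nlinarith
  subst hb
  refine ⟨?_, rfl, rfl⟩
  simpa using h

/-! ## §3 Separation of the `σ`-layers of (★) -/

/-- The exponents `k(p+1)`, `1 ≤ k ≤ p−1`, are not multiples of `p` (they carry the Hasse derivatives `D^{(k)}_{d″}F₀` alone). (derived here)
[cite: Lang2002, Ch. IV §1] -/
theorem not_dvd_mul_succ {p k : ℕ} (hk1 : 1 ≤ k) (hkp : k < p) : ¬ p ∣ k * (p + 1) := by
  intro h
  have h3 : k * (p + 1) = p * k + k := by ring
  rw [h3] at h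
  have hk : p ∣ k := (Nat.dvd_add_right (dvd_mul_right p k)).mp h
  exact absurd (Nat.le_of_dvd (by omega) hk) (by omega)

/-- A coincidence `k(p+1) = k'p` with `1 ≤ k ≤ p` happens only at `k = p`, `k' = p+1` (the layer `σ^{p(p+1)}`: the scalar condition
`Σ a_i d_i^p + F₀(d″) + Q(c) = 0`). (derived here) [cite: Lang2002, Ch. IV §1] -/
theorem mul_succ_eq_mul {p k k' : ℕ} (hp : 0 < p) (hk1 : 1 ≤ k) (hkp : k ≤ p) (h : k * (p + 1) = k' * p) : k = p ∧ k' = p + 1 := by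
  have hk : k = p := by
    rcases Nat.lt_or_ge k p with hlt | hge
    · exact absurd (⟨k', by rw [h]; ring⟩ : p ∣ k * (p + 1)) (not_dvd_mul_succ hk1 hlt)
    · omega
  subst hk
  refine ⟨rfl, ?_⟩
  have h' : k * (k + 1) = k * k' := by rw [h]; ring
  exact (Nat.eq_of_mul_eq_mul_left hp h').symm

/-- In particular no `F₀`-layer `σ^{k(p+1)}` (`k ≥ 1`) meets the layer `σ^p` of `Σ a_i ℓ_i^p + ∂_c Q` unless `p = k = 1`… precisely:
`k(p+1) = p` is impossible for `p ≥ 1`. (derived here) [cite: Lang2002, Ch. IV §1] -/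
theorem mul_succ_ne {p k : ℕ} (hp : 0 < p) : k * (p + 1) ≠ p := by
  intro h
  rcases k with _ | k
  · omega
  · nlinarith

/-! ## §4 Binomial coefficients modulo `p` (the triangular elimination of the `Q_a`) -/

/-- No binomial coefficient `C(a,k)` with `k ≤ a < p` is divisible by the prime `p` (Mathlib: `Nat.Prime.coprime_choose_of_lt`), hence
each is a unit in characteristic `p`: `C(a,2) ≠ 0` in `k` for `2 ≤ a ≤ p−1` (kills `Q_a`, `2 ≤ a ≤ p−1`), `C(p−1,k) ≠ 0`, etc.
(derived here) [cite: Lang2002, Ch. IV §1] -/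
theorem cast_choose_ne_zero (K : Type*) [AddMonoidWithOne K] {p : ℕ} [CharP K p] (hp : p.Prime) {a k : ℕ} (hka : k ≤ a)
    (hap : a < p) : ((a.choose k : ℕ) : K) ≠ 0 := by
  rw [ne_eq, CharP.cast_eq_zero_iff K p]
  exact (Nat.Prime.coprime_iff_not_dvd hp).mp (hp.coprime_choose_of_lt hap hka)

/-- `C(p,p) = 1` (kills `Q_p` at `k = p`). [cite: Lang2002, Ch. IV §1] -/
theorem cast_choose_self (K : Type*) [AddMonoidWithOne K] (p : ℕ) : ((p.choose p : ℕ) : K) = 1 := by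
  rw [Nat.choose_self, Nat.cast_one]

/-- `C(p+1,p) = p+1 ≡ 1` in characteristic `p` (kills `Q_{p+1}` at `k = p`). (derived here) [cite: Lang2002, Ch. IV §1] -/
theorem cast_choose_succ_self (K : Type*) [AddMonoidWithOne K] (p : ℕ) [CharP K p] : (((p + 1).choose p : ℕ) : K) = 1 := by
  rw [Nat.choose_succ_self_right, Nat.cast_succ, CharP.cast_eq_zero K p, zero_add]

/-- Why `k = 2` does NOT kill `a = p`: `p ∣ C(p,2)` for odd `p` (indeed for every prime `p ≥ 3`; `C(p,2) = p(p−1)/2`). (derived here)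
[cite: Lang2002, Ch. IV §1] -/
theorem dvd_choose_two_self {p : ℕ} (hp : p.Prime) (h3 : 3 ≤ p) : p ∣ p.choose 2 :=
  hp.dvd_choose_self (by omega) (by omega)

/-- … nor `a = p+1`: `p ∣ C(p+1,2) = (p+1)p/2` for odd `p`. (derived here) [cite: Lang2002, Ch. IV §1] -/
theorem dvd_choose_two_succ {p : ℕ} (hodd : Odd p) : p ∣ (p + 1).choose 2 := by
  obtain ⟨m, rfl⟩ := hodd
  rw [Nat.choose_two_right]
  refine ⟨m + 1, ?_⟩
  have h : (2 * m + 1 + 1) * (2 * m + 1 + 1 - 1) = 2 * ((2 * m + 1) * (m + 1)) := by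
    rw [Nat.add_sub_cancel]
    ring
  rw [h, Nat.mul_div_cancel_left _ (by norm_num)]

/-! ## §5 Frobenius identities of the proof -/

section Frobenius

variable {A : Type*} [CommRing A] (p : ℕ) [Fact p.Prime] [CharP A p]

/-- `v^p = (σℓ + σ^{p+1}d)^p = σ^p ℓ^p + σ^{p(p+1)} d^p` in characteristic `p`. (derived here)
[cite: Hironaka1970AdditiveGroups, additive polynomials] -/
theorem shift_pow_char (σ ℓ d : A) : (σ * ℓ + σ ^ (p + 1) * d) ^ p = σ ^ p * ℓ ^ p + σ ^ (p * (p + 1)) * d ^ p := by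
  rw [add_pow_char _ _ p, mul_pow, mul_pow, ← pow_mul, mul_comm (p + 1) p]

/-- `ℓ^p = Σ_j c_j^p W_j^p` for a linear form `ℓ = Σ_j c_j W_j` in characteristic `p` (so `Σ_i a_i ℓ_i^p = Σ_j (Σ_i a_i c_{ij}^p) W_j^p`, and
"`Q₁ ∈ k[W′]`" is the scalar relation `Σ_i a_i c_{in}^p = 0`). (derived here) [cite: Hironaka1970AdditiveGroups, additive polynomials] -/
theorem linearForm_pow_char {ι : Type*} (s : Finset ι) (c W : ι → A) :
    (∑ j ∈ s, c j * W j) ^ p = ∑ j ∈ s, c j ^ p * W j ^ p := by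
  rw [sum_pow_char]
  exact Finset.sum_congr rfl fun j _ => mul_pow _ _ _

/-- `(W + t)^{p+1} = (W + t)(W^p + t^p) = W^{p+1} + t·W^p + t^p·W + t^{p+1}` in characteristic `p` — the `t·W_n^p`-term is the one that
kills `Q_{p+1}` in the `r = 0` branch of the proof. (derived here) [cite: Hironaka1970AdditiveGroups, additive polynomials] -/
theorem add_pow_succ_char (W t : A) :
    (W + t) ^ (p + 1) = W ^ (p + 1) + t * W ^ p + t ^ p * W + t ^ (p + 1) := by
  rw [pow_succ, add_pow_char _ _ p, pow_succ, pow_succ]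
  ring

/-- THEOREM B⁗ (iv), the one computation: `(f + σℓ + dσ^{p+1})^p = f^p + σ^p ℓ^p + d^p σ^{p(p+1)}` in characteristic `p`.
(derived here) [cite: Lang2002, Ch. V §6] -/
theorem shift_f_pow_char (f σ ℓ d : A) :
    (f + σ * ℓ + d * σ ^ (p + 1)) ^ p = f ^ p + σ ^ p * ℓ ^ p + d ^ p * σ ^ (p * (p + 1)) := by
  rw [add_pow_char _ _ p, add_pow_char _ _ p, mul_pow, mul_pow, ← pow_mul, mul_comm (p + 1) p]

/-- **THEOREM B⁗ (iv), TWISTED FLOW IDENTITY** (ours as a formal statement; the engine's derivation verbatim): if `g = a f^p + g₀` is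
fixed by a substitution sending `f ↦ f + σℓ + dσ^{p+1}` and `g₀ ↦ Ψg₀` (all other data living in a commutative ring of characteristic
`p`), then `Ψg₀ = g₀ − a ℓ^p u − a d^p u^{p+1}` with `u = σ^p`. [cite: Lang2002, Ch. V §6] -/
theorem twisted_flow_identity (a f σ ℓ d g₀ Ψg₀ : A)
    (hfix : a * (f + σ * ℓ + d * σ ^ (p + 1)) ^ p + Ψg₀ = a * f ^ p + g₀) :
    Ψg₀ = g₀ - a * ℓ ^ p * σ ^ p - a * d ^ p * (σ ^ p) ^ (p + 1) := by
  rw [shift_f_pow_char p] at hfix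
  rw [← pow_mul]
  linear_combination hfix

end Frobenius

/-! ## §6 The count -/

/-- `#faces = (p−1)²p(p+1)` and `#pairs (g,Φ) = (p−1)³p(p+1)`: `96` at `p = 3`. [cite: AbramovichTemkinWlodarczyk2024, §5] -/
theorem count_pairs_3 : (3 - 1) ^ 3 * 3 * (3 + 1) = 96 := by norm_num

/-- `1920` at `p = 5`. [cite: AbramovichTemkinWlodarczyk2024, §5] -/
theorem count_pairs_5 : (5 - 1) ^ 3 * 5 * (5 + 1) = 1920 := by norm_num

/-- `12096` at `p = 7`. [cite: AbramovichTemkinWlodarczyk2024, §5] -/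
theorem count_pairs_7 : (7 - 1) ^ 3 * 7 * (7 + 1) = 12096 := by norm_num

/-- and the face counts `(p−1)²p(p+1) = 48, 480, 2016`. [cite: AbramovichTemkinWlodarczyk2024, §5] -/
theorem count_faces : (3 - 1) ^ 2 * 3 * (3 + 1) = 48 ∧ (5 - 1) ^ 2 * 5 * (5 + 1) = 480 ∧ (7 - 1) ^ 2 * 7 * (7 + 1) = 2016 := by
  norm_num

end TwoClassArith

end Literature.AlgebraicGeometry.Resolution.WeightedBlowup
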